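import Summits.NavierStokesRegularity.NavierStokesRegularity.Theorems.EfficiencyFloorRigidExitReferenceFlowDissipation
import Literature.Analysis.FluidPDE.NSRobustnessOfRegularity
import Literature.Analysis.FluidPDE.LocalBiotSavartCalculus
import Literature.Analysis.FluidPDE.ConstantinDirectionDissipationCalculus
import Literature.Analysis.FluidPDE.AxisymNoSwirlTaoBounds
import HarnessLib

/-!
# Route `EfficiencyFloor`, support `RigidExit` (stmt-NavierStokesRegularity-25513) on the `ProductionEfficiencyDecay` ladder
# (stmt-NavierStokesRegularity-22866): THE GRÖNWALL RATE OF THE REFERENCE FLOW IS UNIFORMLY INTEGRABLE DOWN TO `t = 0⁺`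

Helper file (`--supports stmt-NavierStokesRegularity-22866`; line `efficiency_floor`). Item 3 of the (R-shadow) census of `RigidExit`
(hand g24): the robustness-of-regularity estimate (RRS Thm 9.1) is to be run with REFERENCE = Leray's flow `v` through a normalised
maximiser `m` on windows `[δ, τ]`, `δ → 0⁺`; its Grönwall exponent must stay bounded as `δ → 0⁺`. With the printed slicewise rate
(`…ReferenceShadowingRobustness.robustness_window_of_le`: at each slice some `M ≥ ‖v(s)‖_∞` with `2M²/ν + 27A⁴G²/(2ν³) ≤ l(s)`)
this file proves exactly that, choosing by Agmon `M(s) = A(G(s)·∫‖Δv(s)‖²)^{1/4}` and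
`l(s) = (A²/ν)(G(s) + 2·Pal(s)) + 27A⁴G(s)²/(2ν³)`, `G = ∫|∇v|²_F = Z(v s)`, `Pal = ∫|∇curl v|²_F`:

* `slice_agmon` — at every slice `s ∈ (0,T]`: `‖v(s,·)‖ ≤ M`, `M² ≤ A²(G + 2Pal)/2` (Agmon `‖v‖_∞ ≤ A(∫|∇v|²_F∫‖Δv‖²)^{1/4}`,
  `Δv = −curl curl v`, `|curl w|² ≤ 2|∇w|²_F`, AM–GM);
* `rate_window` — for `0 < τ₁ < T` inside the window ceiling (`2K·Z(m)²·τ₁ ≤ 1/2`, `K = 27c⁴/(128ν³)`): ONE number `B` with, for all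
  `0 < δ < τ ≤ τ₁`: `l` is continuous on `[δ,τ]`, has the slicewise property, and `∫_δ^τ l ≤ B` (window ceiling `Z(v t) ≤ 2Z(m)`
  (p839813), div–curl `G = Z`, dissipation budget `ν∫Pal ≤ Z(δ) − Z(τ) + (27c⁴/16ν³)∫Z³` (p840013), palinstrophy continuity (p839992)).

HONEST FRAMING: bookkeeping along one smooth solution; (R-shadow), `RigidExit`, `NearMaximiserBoundedAmplification`, `LerayFloorGap`,
`ProductionEfficiencyDecay` (stmt-22866) and Navier–Stokes regularity stay OPEN; no summit statement is proved. [folklore]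
-/

-- the problem directory repeats the summit name (`NavierStokesRegularity/NavierStokesRegularity`)
set_option linter.dupNamespace false

noncomputable section

open Set Filter MeasureTheory Topology Function InnerProductSpace
open scoped InnerProductSpace RealInnerProductSpace ENNReal NNReal ContDiff Laplacian
open Literature.Analysis.FluidPDE

namespace Summit.NavierStokesRegularity.NavierStokesRegularity.Theorems

namespace RigidExit

namespace ReferenceShadowing

section Rate

variable {ν T : ℝ} {m : EuclideanSpace ℝ (Fin 3) → EuclideanSpace ℝ (Fin 3)}
  {v : ℝ → EuclideanSpace ℝ (Fin 3) → EuclideanSpace ℝ (Fin 3)} {q : ℝ → EuclideanSpace ℝ (Fin 3) → ℝ}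

/-- **Slicewise Agmon bound in palinstrophy currency.** Along a classical solution on `(0,T]` with all Sobolev norms bounded on
every `[δ,T]`, at each slice `s ∈ (0,T]` there is `M ≥ 0` with `‖v(s,x)‖ ≤ M` for all `x` and
`M² ≤ A²·(∫|∇v(s)|²_F + 2∫|∇curl v(s)|²_F)/2` (`A = agmonConst`): Agmon's inequality `‖v‖_∞ ≤ A(∫|∇v|²_F·∫‖Δv‖²)^{1/4}`,
`Δv = −curl curl v` for divergence-free `v`, `‖curl w‖² ≤ 2|∇w|²_F`, and AM–GM.
[cite: RobinsonRodrigoSadowskiCUP2016, Thm 1.20] -/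
theorem slice_agmon (hcl : IsClassicalNSSolutionOn (Ioc 0 T) ν 0 v q)
    (hB : ∀ δ : ℝ, 0 < δ → δ ≤ T → HasBoundedSobolevNormsOn (Icc δ T) v) {s : ℝ} (hs : s ∈ Ioc 0 T) :
    ∃ M : ℝ, 0 ≤ M ∧ (∀ x, ‖v s x‖ ≤ M) ∧
      M ^ 2 ≤ agmonConst ^ 2 * (((∫ x, frobeniusNormSq (fderiv ℝ (v s) x)) +
        2 * ∫ x, frobeniusNormSq (fderiv ℝ (curl (v s)) x)) / 2) := by
  have hfin : ∀ n : ℕ, ∫⁻ x, ‖iteratedFDeriv ℝ n (v s) x‖ₑ ^ 2 < ⊤ := fun n => by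
    obtain ⟨C, hC⟩ := hB s hs.1 hs.2 n
    exact (hC s ⟨le_rfl, hs.2⟩).trans_lt ENNReal.coe_lt_top
  have hsm : ContDiff ℝ ∞ (v s) := hcl.contDiff_velocity hs
  have hsm3 : ContDiff ℝ 3 (v s) := hsm.of_le (by norm_cast)
  have hsm2 : ContDiff ℝ 2 (v s) := hsm.of_le (by norm_cast)
  set G : ℝ := ∫ x, frobeniusNormSq (fderiv ℝ (v s) x) with hGdef
  set Y : ℝ := ∫ x, ‖(Δ (v s)) x‖ ^ 2 with hYdef
  set P : ℝ := ∫ x, frobeniusNormSq (fderiv ℝ (curl (v s)) x) with hPdef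
  have hG : 0 ≤ G := integral_nonneg fun _ => frobeniusNormSq_nonneg _
  have hY : 0 ≤ Y := integral_nonneg fun _ => by positivity
  have hP : 0 ≤ P := integral_nonneg fun _ => frobeniusNormSq_nonneg _
  -- `Y ≤ 2P`
  have hYP : Y ≤ 2 * P := by
    have hint := (integrable_frobeniusNormSq_fderiv_curl hsm3 (hfin 2)).1
    calc Y = ∫ x, ‖curl (curl (v s)) x‖ ^ 2 := integral_congr_ae (Eventually.of_forall fun x => by
            simp only
            rw [laplacian_eq_neg_curl_curl hsm2 (hcl.divFree s hs) x, norm_neg])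
      _ ≤ ∫ x, 2 * frobeniusNormSq (fderiv ℝ (curl (v s)) x) :=
          integral_mono_of_nonneg (Eventually.of_forall fun x => by positivity) (hint.const_mul 2)
            (Eventually.of_forall fun x => norm_curl_sq_le_two_mul_frobeniusNormSq _ x)
      _ = 2 * P := integral_const_mul _ _
  have hA := agmonConst_nonneg
  refine ⟨agmonConst * (G * Y) ^ (1 / 4 : ℝ), by positivity,
    fun x => norm_le_agmonConst_mul_rpow hsm (hfin 0) (hfin 1) (hfin 2) (hfin 3) x, ?_⟩
  have hGY : 0 ≤ G * Y := mul_nonneg hG hY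
  have h1 : ((G * Y) ^ (1 / 4 : ℝ)) ^ 2 = (G * Y) ^ (1 / 2 : ℝ) := by
    rw [← Real.rpow_mul_natCast hGY]
    norm_num
  have h2 : (G * Y) ^ (1 / 2 : ℝ) ≤ (G + Y) / 2 := by
    have hsq : G * Y ≤ ((G + Y) / 2) ^ 2 := by nlinarith [sq_nonneg (G - Y)]
    calc (G * Y) ^ (1 / 2 : ℝ) ≤ (((G + Y) / 2) ^ 2) ^ (1 / 2 : ℝ) := Real.rpow_le_rpow hGY hsq (by norm_num)
      _ = (G + Y) / 2 := by
          rw [show (1 / 2 : ℝ) = ((2 : ℕ) : ℝ)⁻¹ by norm_num, Real.pow_rpow_inv_natCast (by positivity) two_ne_zero]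
  calc (agmonConst * (G * Y) ^ (1 / 4 : ℝ)) ^ 2 = agmonConst ^ 2 * (G * Y) ^ (1 / 2 : ℝ) := by rw [mul_pow, h1]
    _ ≤ agmonConst ^ 2 * ((G + Y) / 2) := mul_le_mul_of_nonneg_left h2 (sq_nonneg _)
    _ ≤ agmonConst ^ 2 * ((G + 2 * P) / 2) := by gcongr

/-- **The Grönwall rate of the reference flow is uniformly integrable on windows `[δ,τ] ⊂ (0,τ₁]`.** Let `(v,q)` be the
reference flow through an admissible `m` with `Z(m) > 0` (Leray package on `[0,T]`: Leray–Hopf from `m`, `H¹`-regular, classical on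
`(0,T]`, Sobolev bounds of `v`, `∂ₜv` on every `[δ,T]`), `c` a one-sided admissible Lu–Doering constant, and `0 < τ₁ < T` with
`2K·Z(m)²·τ₁ ≤ 1/2`, `K = 27c⁴/(128ν³)`. With the rate `l(s) = (A²/ν)(∫|∇v(s)|²_F + 2∫|∇curl v(s)|²_F) + 27A⁴(∫|∇v(s)|²_F)²/(2ν³)`
there is ONE number `B` such that for all `0 < δ < τ ≤ τ₁`: `l` is continuous on `[δ,τ]`; at every `s ∈ [δ,τ]` some `M ≥ 0` has
`‖v(s,·)‖ ≤ M` and `2M²/ν + 27A⁴(∫|∇v(s)|²_F)²/(2ν³) ≤ l(s)`; and `∫_δ^τ l ≤ B`. [folklore] -/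
theorem rate_window (hν : 0 < ν) (hT : 0 < T) (hLH : IsLerayHopfOn T ν 0 m v) (hv0 : v 0 = m)
    (hH1 : IsH1RegularOn (Icc 0 T) v) (hcl : IsClassicalNSSolutionOn (Ioc 0 T) ν 0 v q)
    (hB : ∀ δ : ℝ, 0 < δ → δ ≤ T → HasBoundedSobolevNormsOn (Icc δ T) v)
    (hBt : ∀ δ : ℝ, 0 < δ → δ ≤ T → HasBoundedSobolevNormsOn (Icc δ T) (timeDerivWithin (Ioc 0 T) v))
    (hm : ContDiff ℝ (⊤ : ℕ∞) m ∧ VectorCalculus.IsDivFree m ∧ (∫⁻ x, ‖iteratedFDeriv ℝ 0 m x‖ₑ ^ 2 < ⊤) ∧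
      (∫⁻ x, ‖iteratedFDeriv ℝ 1 m x‖ₑ ^ 2 < ⊤) ∧ (∫⁻ x, ‖iteratedFDeriv ℝ 2 m x‖ₑ ^ 2 < ⊤))
    {c : ℝ}
    (hc : ∀ w : EuclideanSpace ℝ (Fin 3) → EuclideanSpace ℝ (Fin 3), (ContDiff ℝ (⊤ : ℕ∞) w ∧
      VectorCalculus.IsDivFree w ∧ (∫⁻ x, ‖iteratedFDeriv ℝ 0 w x‖ₑ ^ 2 < ⊤) ∧
      (∫⁻ x, ‖iteratedFDeriv ℝ 1 w x‖ₑ ^ 2 < ⊤) ∧ (∫⁻ x, ‖iteratedFDeriv ℝ 2 w x‖ₑ ^ 2 < ⊤)) →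
      (∫ x, ⟪curl w x, fderiv ℝ w x (curl w x)⟫_ℝ) ≤ c * (∫ x, ‖curl w x‖ ^ 2) ^ (3 / 4 : ℝ) *
        (∫ x, frobeniusNormSq (fderiv ℝ (curl w) x)) ^ (3 / 4 : ℝ))
    (hZm : 0 < ∫ x, ‖curl m x‖ ^ 2) {τ₁ : ℝ} (hτ₁T : τ₁ < T)
    (hwin : 2 * (27 * c ^ 4 / (128 * ν ^ 3)) * (∫ x, ‖curl m x‖ ^ 2) ^ 2 * τ₁ ≤ 1 / 2) :
    ∃ B : ℝ, ∀ δ τ : ℝ, 0 < δ → δ < τ → τ ≤ τ₁ →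
      ContinuousOn (fun s => agmonConst ^ 2 / ν * ((∫ x, frobeniusNormSq (fderiv ℝ (v s) x)) +
          2 * ∫ x, frobeniusNormSq (fderiv ℝ (curl (v s)) x)) +
        27 * agmonConst ^ 4 * (∫ x, frobeniusNormSq (fderiv ℝ (v s) x)) ^ 2 / (2 * ν ^ 3)) (Icc δ τ) ∧
      (∀ s ∈ Icc δ τ, ∃ M : ℝ, 0 ≤ M ∧ (∀ x, ‖v s x‖ ≤ M) ∧
        2 * M ^ 2 / ν + 27 * agmonConst ^ 4 * (∫ x, frobeniusNormSq (fderiv ℝ (v s) x)) ^ 2 / (2 * ν ^ 3) ≤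
          agmonConst ^ 2 / ν * ((∫ x, frobeniusNormSq (fderiv ℝ (v s) x)) +
              2 * ∫ x, frobeniusNormSq (fderiv ℝ (curl (v s)) x)) +
            27 * agmonConst ^ 4 * (∫ x, frobeniusNormSq (fderiv ℝ (v s) x)) ^ 2 / (2 * ν ^ 3)) ∧
      (∫ s in δ..τ, (agmonConst ^ 2 / ν * ((∫ x, frobeniusNormSq (fderiv ℝ (v s) x)) +
          2 * ∫ x, frobeniusNormSq (fderiv ℝ (curl (v s)) x)) +
        27 * agmonConst ^ 4 * (∫ x, frobeniusNormSq (fderiv ℝ (v s) x)) ^ 2 / (2 * ν ^ 3))) ≤ B := by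
  have hA := agmonConst_nonneg
  set Zm : ℝ := ∫ x, ‖curl m x‖ ^ 2 with hZmdef
  set K : ℝ := 27 * c ^ 4 / (128 * ν ^ 3) with hK
  -- the enstrophy of the reference flow: continuity, window ceiling `Z(v t) ≤ 2 Z(m)` on `(0, τ₁]`
  have hZnn : ∀ t, 0 ≤ ∫ x, ‖curl (v t) x‖ ^ 2 := fun t => integral_nonneg fun x => by positivity
  have hZle : ∀ t ∈ Ioc 0 τ₁, (∫ x, ‖curl (v t) x‖ ^ 2) ≤ 2 * Zm := by
    intro t ht
    have hcei := ReferenceFlow.enstrophy_sq_mul_le hν hT hLH hv0 hH1 hcl hB hm hc hZm ⟨ht.1.le, ht.2.trans_lt hτ₁T⟩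
    have hKt : 2 * K * Zm ^ 2 * t ≤ 1 / 2 := by
      have hK0 : 0 ≤ 2 * K * Zm ^ 2 := by positivity
      calc 2 * K * Zm ^ 2 * t ≤ 2 * K * Zm ^ 2 * τ₁ := mul_le_mul_of_nonneg_left ht.2 hK0
        _ ≤ 1 / 2 := hwin
    have hZt := hZnn t
    have hsq : (∫ x, ‖curl (v t) x‖ ^ 2) ^ 2 ≤ (2 * Zm) ^ 2 := by nlinarith [sq_nonneg (∫ x, ‖curl (v t) x‖ ^ 2)]
    exact (pow_le_pow_iff_left₀ hZt (by positivity) two_ne_zero).1 hsq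
  -- Sobolev finiteness and div–curl `G = Z` at positive times
  have hfin : ∀ s ∈ Ioc 0 T, ∀ n : ℕ, ∫⁻ x, ‖iteratedFDeriv ℝ n (v s) x‖ₑ ^ 2 < ⊤ := fun s hs n => by
    obtain ⟨C, hC⟩ := hB s hs.1 hs.2 n
    exact (hC s ⟨le_rfl, hs.2⟩).trans_lt ENNReal.coe_lt_top
  have hGZ : ∀ s ∈ Ioc 0 T, (∫ x, frobeniusNormSq (fderiv ℝ (v s) x)) = ∫ x, ‖curl (v s) x‖ ^ 2 := by
    intro s hs
    have hsm : ContDiff ℝ ∞ (v s) := hcl.contDiff_velocity hs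
    have h0 : ∫⁻ x, ‖v s x‖ₑ ^ 2 < ⊤ := by
      refine lt_of_le_of_lt (le_of_eq (lintegral_congr fun x => ?_)) (hfin s hs 0)
      rw [← ofReal_norm, ← ofReal_norm, norm_iteratedFDeriv_zero]
    exact integral_frobeniusNormSq_fderiv_eq_integral_norm_curl_sq (hsm.of_le (by norm_cast)) (hcl.divFree s hs)
      h0 (hfin s hs 1) (hfin s hs 2)
  -- the bound
  refine ⟨agmonConst ^ 2 / ν * (2 * Zm * τ₁ + 2 * ((2 * Zm + 27 * c ^ 4 / (16 * ν ^ 3) * ((2 * Zm) ^ 3 * τ₁)) / ν)) +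
      27 * agmonConst ^ 4 * ((2 * Zm) ^ 2 * τ₁) / (2 * ν ^ 3), fun δ τ hδ hδτ hττ₁ => ?_⟩
  have hτT : τ < T := hττ₁.trans_lt hτ₁T
  have hδT : δ < T := hδτ.trans hτT
  have hsub : Icc δ τ ⊆ Ioc 0 T := fun s hs => ⟨hδ.trans_le hs.1, hs.2.trans hτT.le⟩
  have hsub₁ : Icc δ τ ⊆ Ioc 0 τ₁ := fun s hs => ⟨hδ.trans_le hs.1, hs.2.trans hττ₁⟩
  -- continuity of `Z`, `G`, `Pal` on `[δ, τ]`
  have hZc : ContinuousOn (fun s => ∫ x, ‖curl (v s) x‖ ^ 2) (Icc δ τ) := fun s hs =>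
    (ReferenceFlow.enstrophy_continuousAt hν hcl hB ⟨hδ.trans_le hs.1, hs.2.trans_lt hτT⟩).continuousWithinAt
  have hGc : ContinuousOn (fun s => ∫ x, frobeniusNormSq (fderiv ℝ (v s) x)) (Icc δ τ) :=
    hZc.congr fun s hs => hGZ s (hsub hs)
  have hPc : ContinuousOn (fun s => ∫ x, frobeniusNormSq (fderiv ℝ (curl (v s)) x)) (Icc δ τ) :=
    (ReferenceFlow.continuousOn_palinstrophy hcl hB hBt hδ hδT).mono (Icc_subset_Icc_right hτT.le)
  have hlc : ContinuousOn (fun s => agmonConst ^ 2 / ν * ((∫ x, frobeniusNormSq (fderiv ℝ (v s) x)) +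
          2 * ∫ x, frobeniusNormSq (fderiv ℝ (curl (v s)) x)) +
        27 * agmonConst ^ 4 * (∫ x, frobeniusNormSq (fderiv ℝ (v s) x)) ^ 2 / (2 * ν ^ 3)) (Icc δ τ) :=
    (continuousOn_const.mul (hGc.add (continuousOn_const.mul hPc))).add
      ((continuousOn_const.mul (hGc.pow 2)).div_const _)
  refine ⟨hlc, fun s hs => ?_, ?_⟩
  · -- the slicewise property
    obtain ⟨M, hM0, hM, hM2⟩ := slice_agmon hcl hB (hsub hs)
    refine ⟨M, hM0, hM, ?_⟩
    have h2 : 2 * M ^ 2 / ν ≤ agmonConst ^ 2 / ν * ((∫ x, frobeniusNormSq (fderiv ℝ (v s) x)) +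
        2 * ∫ x, frobeniusNormSq (fderiv ℝ (curl (v s)) x)) := by
      rw [div_mul_eq_mul_div, div_le_div_iff_of_pos_right hν]
      linarith
    linarith
  · -- the integral bound
    have hGi : IntervalIntegrable (fun s => ∫ x, frobeniusNormSq (fderiv ℝ (v s) x)) volume δ τ :=
      hGc.intervalIntegrable_of_Icc hδτ.le
    have hPi : IntervalIntegrable (fun s => ∫ x, frobeniusNormSq (fderiv ℝ (curl (v s)) x)) volume δ τ :=
      hPc.intervalIntegrable_of_Icc hδτ.le
    have hG2i : IntervalIntegrable (fun s => (∫ x, frobeniusNormSq (fderiv ℝ (v s) x)) ^ 2) volume δ τ :=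
      (hGc.pow 2).intervalIntegrable_of_Icc hδτ.le
    -- `∫ G ≤ 2 Zm τ₁`, `∫ G² ≤ (2Zm)² τ₁`
    have hGle : ∀ s ∈ Icc δ τ, (∫ x, frobeniusNormSq (fderiv ℝ (v s) x)) ≤ 2 * Zm := fun s hs => by
      rw [hGZ s (hsub hs)]; exact hZle s (hsub₁ hs)
    have hG0 : ∀ s, 0 ≤ ∫ x, frobeniusNormSq (fderiv ℝ (v s) x) := fun s => integral_nonneg fun _ => frobeniusNormSq_nonneg _
    have hIG : (∫ s in δ..τ, ∫ x, frobeniusNormSq (fderiv ℝ (v s) x)) ≤ 2 * Zm * τ₁ := by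
      calc (∫ s in δ..τ, ∫ x, frobeniusNormSq (fderiv ℝ (v s) x)) ≤ ∫ s in δ..τ, 2 * Zm :=
            intervalIntegral.integral_mono_on hδτ.le hGi intervalIntegrable_const hGle
        _ = (τ - δ) * (2 * Zm) := by rw [intervalIntegral.integral_const, smul_eq_mul]
        _ ≤ τ₁ * (2 * Zm) := mul_le_mul_of_nonneg_right (by linarith) (by positivity)
        _ = 2 * Zm * τ₁ := by ring
    have hIG2 : (∫ s in δ..τ, (∫ x, frobeniusNormSq (fderiv ℝ (v s) x)) ^ 2) ≤ (2 * Zm) ^ 2 * τ₁ := by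
      calc (∫ s in δ..τ, (∫ x, frobeniusNormSq (fderiv ℝ (v s) x)) ^ 2) ≤ ∫ s in δ..τ, (2 * Zm) ^ 2 :=
            intervalIntegral.integral_mono_on hδτ.le hG2i intervalIntegrable_const fun s hs =>
              pow_le_pow_left₀ (hG0 s) (hGle s hs) 2
        _ = (τ - δ) * (2 * Zm) ^ 2 := by rw [intervalIntegral.integral_const, smul_eq_mul]
        _ ≤ τ₁ * (2 * Zm) ^ 2 := mul_le_mul_of_nonneg_right (by linarith) (by positivity)
        _ = (2 * Zm) ^ 2 * τ₁ := by ring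
    -- `∫ Pal ≤ (2Zm + (27c⁴/16ν³)(2Zm)³τ₁)/ν` by the dissipation budget
    have hdis := (ReferenceFlow.dissipation_budget hν hcl hB hBt hc hδ hδτ hτT).2
    have hZ3i : IntervalIntegrable (fun s => (∫ x, ‖curl (v s) x‖ ^ 2) ^ 3) volume δ τ :=
      (hZc.pow 3).intervalIntegrable_of_Icc hδτ.le
    have hIZ3 : (∫ s in δ..τ, (∫ x, ‖curl (v s) x‖ ^ 2) ^ 3) ≤ (2 * Zm) ^ 3 * τ₁ := by
      calc (∫ s in δ..τ, (∫ x, ‖curl (v s) x‖ ^ 2) ^ 3) ≤ ∫ s in δ..τ, (2 * Zm) ^ 3 :=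
            intervalIntegral.integral_mono_on hδτ.le hZ3i intervalIntegrable_const fun s hs =>
              pow_le_pow_left₀ (hZnn s) (hZle s (hsub₁ hs)) 3
        _ = (τ - δ) * (2 * Zm) ^ 3 := by rw [intervalIntegral.integral_const, smul_eq_mul]
        _ ≤ τ₁ * (2 * Zm) ^ 3 := mul_le_mul_of_nonneg_right (by linarith) (by positivity)
        _ = (2 * Zm) ^ 3 * τ₁ := by ring
    have hIP : (∫ s in δ..τ, ∫ x, frobeniusNormSq (fderiv ℝ (curl (v s)) x)) ≤
        (2 * Zm + 27 * c ^ 4 / (16 * ν ^ 3) * ((2 * Zm) ^ 3 * τ₁)) / ν := by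
      rw [le_div_iff₀ hν, mul_comm]
      have hZδ := hZle δ ⟨hδ, hδτ.le.trans hττ₁⟩
      have hZτ := hZnn τ
      have hc27 : 0 ≤ 27 * c ^ 4 / (16 * ν ^ 3) := by positivity
      have := mul_le_mul_of_nonneg_left hIZ3 hc27
      linarith
    -- assemble
    rw [intervalIntegral.integral_add (hGi.add (hPi.const_mul 2) |>.const_mul _) (hG2i.const_mul _ |>.div_const _),
      intervalIntegral.integral_const_mul, intervalIntegral.integral_add hGi (hPi.const_mul 2),
      intervalIntegral.integral_const_mul, intervalIntegral.integral_div, intervalIntegral.integral_const_mul]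
    have hP0 : 0 ≤ ∫ s in δ..τ, ∫ x, frobeniusNormSq (fderiv ℝ (curl (v s)) x) :=
      intervalIntegral.integral_nonneg hδτ.le fun s _ => integral_nonneg fun _ => frobeniusNormSq_nonneg _
    have hA2 : 0 ≤ agmonConst ^ 2 / ν := by positivity
    have hA4 : 0 ≤ 27 * agmonConst ^ 4 := by positivity
    have hν3 : 0 < 2 * ν ^ 3 := by positivity
    have h1 : agmonConst ^ 2 / ν * ((∫ s in δ..τ, ∫ x, frobeniusNormSq (fderiv ℝ (v s) x)) +
        2 * ∫ s in δ..τ, ∫ x, frobeniusNormSq (fderiv ℝ (curl (v s)) x)) ≤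
        agmonConst ^ 2 / ν * (2 * Zm * τ₁ + 2 * ((2 * Zm + 27 * c ^ 4 / (16 * ν ^ 3) * ((2 * Zm) ^ 3 * τ₁)) / ν)) :=
      mul_le_mul_of_nonneg_left (by linarith) hA2
    have h2 : 27 * agmonConst ^ 4 * (∫ s in δ..τ, (∫ x, frobeniusNormSq (fderiv ℝ (v s) x)) ^ 2) / (2 * ν ^ 3) ≤
        27 * agmonConst ^ 4 * ((2 * Zm) ^ 2 * τ₁) / (2 * ν ^ 3) :=
      div_le_div_of_nonneg_right (mul_le_mul_of_nonneg_left hIG2 hA4) hν3.le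
    linarith

end Rate

end ReferenceShadowing

end RigidExit

end Summit.NavierStokesRegularity.NavierStokesRegularity.Theorems

end
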